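import Summits.Ventures.LatticeQCDFlow.Scaling.FlowHubSchemeFloor
import Summits.Ventures.LatticeQCDFlow.Scaling.FlowSamplerTauInt

/-!
HONEST FRAMING: exact (Metropolis-corrected) sampling algorithms for lattice gauge theory; figures
of merit are autocorrelation/cost numbers at stated couplings and volumes; no continuum-physics
claim.

# FlowHubTauInt — THE HUB EXCHANGE SCHEME IS IRREDUCIBLE FROM THE HOT UPDATE ALONE (ANY WEIGHTS WITH `w_0 > 0`, ANY MAPS ON
# THE HUB EDGES), SO THE LINEAR LAW OF `Scaling/WeightedHubSchemeFloor` / `Scaling/FlowHubSchemeFloor` READS, FOR EVERY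
# OBSERVABLE, `τ_int(g) ≤ 10K/min{t, γ₀(1−t)} − ½` (lean-2 GEN-21, ours)

Venture-side (OURS).  Cell `lqcd-flow` (pub-lqcd), unit `pub-lqcd-lean-2-g21`, 2026-08-26.  Chapter I, tenth file: the `τ_int`
currency for the hub (`Scaling/FlowSamplerTauInt` did the ladders and left the hub NOT CLAIMED for want of an
irreducibility lemma).  §1 proves it in the pattern of `Scaling/ReplicaExchangeBareErgodic` (closed sets; the hot
coordinate is filled by the hot update, every cold coordinate through the star conveyor identity
`x^{k+1←v} = ((x∘τ_k)^{0←v})∘τ_k` of `Scaling/ReplicaExchangeStarFloor`), for the weighted star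
`t·ptGraphSwap μ e 1 + (1−t)·prodKernel w M` with ANY weights `w_0 > 0` and ARBITRARY cold updates; the map-assisted
star follows by the level coordinates of `Scaling/FlowHubSchemeFloor` and `isIrreducible_relabel`.  §2 feeds the floors
`min{t,γ₀(1−t)}/(10K)` into `tauInt_le_of_gapFloor`.

## What is proved

* §1 **`weightedStar_isIrreducible_of_hot`** (`M_0` irreducible, `0 < t < 1`, `w_0 > 0`),
  **`flowStar_isIrreducible_of_hot`** (the same with bijections `φ_k` on the hub edges).
* §2 **`hotOnlyStar_tauInt_le`** (identical levels, hot-only updates: `τ_int(g) ≤ 10K/min{t,γ₀(1−t)} − ½` for every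
  non-constant `g`), **`flowStarPerfect_tauInt_le`** (perfect transports `μ_{k+1}∘φ_k = μ_0`, hot-only updates, ARBITRARY
  cold laws: the same ceiling).

Reading (no numerics implied): one accepted swap away from a freely tunnelling replica, every observable of `K` passive cold
replicas decorrelates within order `K` steps — the linear law as an autocorrelation time.  NOT CLAIMED: general swap
graphs beyond the hub edges' role; anything measured.  Literature grade (cell rule): OWN COROLLARIES; nothing cited as a
fact; no new bib keys.
-/

noncomputable section

open Finset Function
open Literature.Probability.MarkovChains

namespace Summit.Ventures.LatticeQCDFlow.Scaling

variable {S : Type*} [Fintype S] [DecidableEq S] {K : ℕ} {μ : Fin (K + 1) → S → ℝ}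
  {M : Fin (K + 1) → S → S → ℝ} {w : Fin (K + 1) → ℝ} {t : ℝ}

/-! ## §1 Irreducibility of the hub scheme from the hot update -/

/-- **The weighted star is irreducible as soon as the HOT update is** (`0 < t < 1`, `w ≥ 0`, `Σw = 1`, `w_0 > 0`,
positive level laws; cold updates arbitrary row-stochastic). [ours] -/
theorem weightedStar_isIrreducible_of_hot (hμ : ∀ k x, 0 < μ k x) (hM : ∀ k, IsRowStochastic (M k))
    (hM0 : IsIrreducible (M 0)) (hw0 : ∀ k, 0 ≤ w k) (hw1 : ∑ k, w k = 1) (hwhot : 0 < w 0) (ht0 : 0 < t) (ht1 : t < 1) :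
    IsIrreducible (fun x y : Fin (K + 1) → S =>
      t * ptGraphSwap μ (fun k : Fin K => ((0 : Fin (K + 1)), k.succ)) (fun _ : Fin K => Equiv.refl S) x y
        + (1 - t) * prodKernel w M x y) := by
  set e : Fin K → Fin (K + 1) × Fin (K + 1) := fun k => ((0 : Fin (K + 1)), k.succ) with he_def
  have he : ∀ j, (e j).1 ≠ (e j).2 := fun k => (Fin.succ_ne_zero k).symm
  have hQ := ptGraphSwap_isRowStochastic (e := e) (φ := fun _ : Fin K => Equiv.refl S) hμ
  have hP0 := (weightedScheme_isRowStochastic hQ hM hw0 hw1 ht0.le ht1.le).1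
  refine isIrreducible_of_forall_closed hP0 fun T hT hcl => ?_
  -- (A) a move of the hot replica
  have moveA : ∀ (x : Fin (K + 1) → S) (v : S), x ∈ T → 0 < M 0 (x 0) v → update x 0 v ∈ T := by
    intro x v hx hv
    by_cases hvx : v = x 0
    · rw [hvx, update_eq_self]; exact hx
    refine hcl x hx (update x 0 v) ?_
    have h := whub_hot_flow_ge (M := M) (w := w) (t := t) hQ.1 hμ ht0.le x hvx
    have hpos : 0 < (1 - t) * w 0 * (tensorFun μ x * M 0 (x 0) v) :=
      mul_pos (mul_pos (by linarith) hwhot) (mul_pos (tensorFun_pos hμ x) hv)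
    exact (mul_pos_iff_of_pos_left (tensorFun_pos hμ x)).mp (lt_of_lt_of_le hpos h)
  -- (B) the whole hot coordinate
  have moveB : ∀ x : Fin (K + 1) → S, x ∈ T → ∀ v, update x 0 v ∈ T := by
    intro x hx v
    set V : Finset S := univ.filter fun u => update x 0 u ∈ T with hV
    have hxk : x 0 ∈ V := by rw [hV, Finset.mem_filter, update_eq_self]; exact ⟨mem_univ _, hx⟩
    have hclV : ∀ u ∈ V, ∀ u', 0 < M 0 u u' → u' ∈ V := by
      intro u hu u' huu'
      rw [hV, Finset.mem_filter] at hu ⊢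
      refine ⟨mem_univ _, ?_⟩
      have := moveA (update x 0 u) u' hu.2 (by rwa [update_self])
      rwa [update_idem] at this
    have hVu := hM0.eq_univ_of_closed (hM 0).1 ⟨x 0, hxk⟩ hclV
    have hv : v ∈ V := by rw [hVu]; exact mem_univ _
    rw [hV, Finset.mem_filter] at hv
    exact hv.2
  -- (C) hub swaps have positive probability
  have swapPos : ∀ (x : Fin (K + 1) → S) (k : Fin K), x ∈ T → x ∘ Equiv.swap (0 : Fin (K + 1)) k.succ ∈ T := by
    intro x k hx
    by_cases hxk : x ∘ Equiv.swap (0 : Fin (K + 1)) k.succ = x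
    · rw [hxk]; exact hx
    refine hcl x hx _ ?_
    have h := whub_swap_flow_ge (M := M) (w := w) e he hμ hM hw0 hw1 ht0.le ht1.le x (k := k) (j := k) rfl hxk
    have hK0 : 0 < K := by have := k.2; omega
    have hpos : 0 < t / K * min (tensorFun μ x) (tensorFun μ (x ∘ Equiv.swap (0 : Fin (K + 1)) k.succ)) :=
      mul_pos (div_pos ht0 (by exact_mod_cast hK0)) (lt_min (tensorFun_pos hμ _) (tensorFun_pos hμ _))
    exact (mul_pos_iff_of_pos_left (tensorFun_pos hμ x)).mp (lt_of_lt_of_le hpos h)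
  -- (D) every coordinate, by the star conveyor identity
  have moveD : ∀ (k : Fin (K + 1)) (x : Fin (K + 1) → S), x ∈ T → ∀ v, update x k v ∈ T := by
    intro k
    induction k using Fin.cases with
    | zero => exact moveB
    | succ l =>
      intro x hx v
      rw [update_succ_eq_conj_swap x l v]
      exact swapPos _ l (moveB _ (swapPos x l hx) v)
  -- (E) everything
  obtain ⟨x₀, hx₀⟩ := hT
  have key : ∀ (y : Fin (K + 1) → S) (s : Finset (Fin (K + 1))), s.piecewise y x₀ ∈ T := by
    intro y s
    induction s using Finset.induction_on with
    | empty => rwa [Finset.piecewise_empty]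
    | insert k s hk ih =>
      rw [Finset.piecewise_insert]
      exact moveD k _ ih _
  refine Finset.eq_univ_of_forall fun y => ?_
  have := key y univ
  rwa [Finset.piecewise_univ] at this

/-- **The map-assisted star is irreducible as soon as the HOT update is** — every family of bijections `φ_k` on the hub
edges, any weights with `w_0 > 0`, arbitrary cold updates (`0 < t < 1`). [ours] -/
theorem flowStar_isIrreducible_of_hot (φ : Fin K → Equiv.Perm S) (hμ : ∀ k x, 0 < μ k x)
    (hM : ∀ k, IsRowStochastic (M k)) (hM0 : IsIrreducible (M 0)) (hw0 : ∀ k, 0 ≤ w k) (hw1 : ∑ k, w k = 1)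
    (hwhot : 0 < w 0) (ht0 : 0 < t) (ht1 : t < 1) :
    IsIrreducible (fun x y : Fin (K + 1) → S =>
      t * ptGraphSwap μ (fun k : Fin K => ((0 : Fin (K + 1)), k.succ)) φ x y + (1 - t) * prodKernel w M x y) := by
  set L : Fin (K + 1) → Equiv.Perm S := Fin.cons (Equiv.refl S) (fun k => (φ k).symm) with hL
  have hL0u : ∀ u, (L 0).symm u = u := fun u => by rw [hL, starLevel_zero]; rfl
  have hM0' : (fun u v => M 0 ((L 0).symm u) ((L 0).symm v)) = M 0 := funext fun u => funext fun v => by rw [hL0u, hL0u]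
  have hirr : IsIrreducible (fun x y : Fin (K + 1) → S =>
      t * ptGraphSwap (fun i u => μ i ((L i).symm u)) (fun k : Fin K => ((0 : Fin (K + 1)), k.succ))
          (fun _ : Fin K => Equiv.refl S) x y
        + (1 - t) * prodKernel w (fun i u v => M i ((L i).symm u) ((L i).symm v)) x y) := by
    refine weightedStar_isIrreducible_of_hot (fun k u => hμ k _)
      (fun k => ⟨fun u v => (hM k).1 _ _,
        fun u => by simpa using (Equiv.sum_comp (L k).symm (fun v => M k ((L k).symm u) v)).trans ((hM k).2 _)⟩)
      ?_ hw0 hw1 hwhot ht0 ht1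
    show IsIrreducible (fun u v => M 0 ((L 0).symm u) ((L 0).symm v))
    rw [hM0']; exact hM0
  have h := isIrreducible_relabel (Equiv.piCongrRight L) hirr
  have e : (fun a b : Fin (K + 1) → S =>
      t * ptGraphSwap (fun i u => μ i ((L i).symm u)) (fun k : Fin K => ((0 : Fin (K + 1)), k.succ))
          (fun _ : Fin K => Equiv.refl S) (Equiv.piCongrRight L a) (Equiv.piCongrRight L b)
        + (1 - t) * prodKernel w (fun i u v => M i ((L i).symm u) ((L i).symm v))
          (Equiv.piCongrRight L a) (Equiv.piCongrRight L b))
      = fun x y : Fin (K + 1) → S =>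
          t * ptGraphSwap μ (fun k : Fin K => ((0 : Fin (K + 1)), k.succ)) φ x y + (1 - t) * prodKernel w M x y := by
    funext a b
    rw [starRelabel_apply, starRelabel_apply]
    exact (flowStar_apply_eq_conj φ hμ t w a b).symm
  rw [e] at h
  exact h

/-! ## §2 `τ_int` of every observable under the hub schemes -/

/-- **HOT-ONLY STAR, EVERY OBSERVABLE:** identical levels, hot update irreducible with Poincaré constant `γ₀`, cold updates
arbitrary: `τ_int(g) ≤ 10K/min{t, γ₀(1−t)} − ½` for every non-constant `g` (`K ≥ 1`, `0 < t < 1`, `|S| ≥ 2`). [ours] -/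
theorem hotOnlyStar_tauInt_le [Nontrivial S] (hK : 1 ≤ K) (hμ : ∀ k x, 0 < μ k x) (hμ1 : ∀ k, ∑ u, μ k u = 1)
    (hM : ∀ k, IsRowStochastic (M k)) (hMrev : ∀ k, DetailedBalance (μ k) (M k)) (hM0 : IsIrreducible (M 0))
    (ht0 : 0 < t) (ht1 : t < 1) (hsame : ∀ k, μ k = μ 0) {γ₀ : ℝ} (hγ₀ : 0 < γ₀)
    (hgap0 : ∀ h : S → ℝ, γ₀ * lawVariance (μ 0) h ≤ dirichletForm (μ 0) (M 0) h)
    {g : (Fin (K + 1) → S) → ℝ} (hg : 0 < lawVariance (tensorFun μ) g) :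
    asympVar g (tensorFun μ) (fun x y : Fin (K + 1) → S =>
        t * ptGraphSwap μ (fun k : Fin K => ((0 : Fin (K + 1)), k.succ)) (fun _ : Fin K => Equiv.refl S) x y
          + (1 - t) * prodKernel (fun k : Fin (K + 1) => if k = 0 then (1 : ℝ) else 0) M x y)
      / (2 * lawVariance (tensorFun μ) g) ≤ 10 * K / min t (γ₀ * (1 - t)) - 1 / 2 := by
  have hKpos : (0 : ℝ) < K := Nat.cast_pos.mpr (by omega)
  have hw0 : ∀ k : Fin (K + 1), 0 ≤ (if k = 0 then (1 : ℝ) else 0) := fun k => by positivity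
  have hc0 : 0 < min t (γ₀ * (1 - t)) / (10 * K) := div_pos (lt_min ht0 (mul_pos hγ₀ (by linarith))) (by positivity)
  have h := tauInt_le_of_gapFloor (tensorFun_pos hμ) (sum_tensorFun_eq_one μ hμ1)
    (weightedScheme_isRowStochastic (ptGraphSwap_isRowStochastic hμ) hM hw0 hotOnlyWeight_sum ht0.le ht1.le)
    (weightedScheme_detailedBalance (ptGraphSwap_detailedBalance hμ) hMrev t)
    (weightedStar_isIrreducible_of_hot hμ hM hM0 hw0 hotOnlyWeight_sum (by simp) ht0 ht1) hc0
    (hotOnlyStar_spectralGap_ge_linear hK hμ hμ1 hM hMrev ht0 ht1 hsame hγ₀ hgap0) hg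
  have e : 1 / (min t (γ₀ * (1 - t)) / (10 * K)) = 10 * K / min t (γ₀ * (1 - t)) := by rw [one_div, inv_div]
  rw [e] at h
  exact h

/-- **MAP-ASSISTED STAR WITH PERFECT TRANSPORTS, EVERY OBSERVABLE:** `μ_{k+1}(φ_k u) = μ_0(u)`, hot-only updates, hot
update irreducible with Poincaré constant `γ₀`, ARBITRARY cold laws: `τ_int(g) ≤ 10K/min{t, γ₀(1−t)} − ½`. [ours] -/
theorem flowStarPerfect_tauInt_le [Nontrivial S] (φ : Fin K → Equiv.Perm S) (hK : 1 ≤ K) (hμ : ∀ k x, 0 < μ k x)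
    (hμ1 : ∀ k, ∑ u, μ k u = 1) (hM : ∀ k, IsRowStochastic (M k)) (hMrev : ∀ k, DetailedBalance (μ k) (M k))
    (hM0 : IsIrreducible (M 0)) (ht0 : 0 < t) (ht1 : t < 1) (hperfect : ∀ (k : Fin K) (u : S), μ k.succ (φ k u) = μ 0 u)
    {γ₀ : ℝ} (hγ₀ : 0 < γ₀) (hgap0 : ∀ h : S → ℝ, γ₀ * lawVariance (μ 0) h ≤ dirichletForm (μ 0) (M 0) h)
    {g : (Fin (K + 1) → S) → ℝ} (hg : 0 < lawVariance (tensorFun μ) g) :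
    asympVar g (tensorFun μ) (fun x y : Fin (K + 1) → S =>
        t * ptGraphSwap μ (fun k : Fin K => ((0 : Fin (K + 1)), k.succ)) φ x y
          + (1 - t) * prodKernel (fun k : Fin (K + 1) => if k = 0 then (1 : ℝ) else 0) M x y)
      / (2 * lawVariance (tensorFun μ) g) ≤ 10 * K / min t (γ₀ * (1 - t)) - 1 / 2 := by
  have hKpos : (0 : ℝ) < K := Nat.cast_pos.mpr (by omega)
  have hw0 : ∀ k : Fin (K + 1), 0 ≤ (if k = 0 then (1 : ℝ) else 0) := fun k => by positivity
  have hc0 : 0 < min t (γ₀ * (1 - t)) / (10 * K) := div_pos (lt_min ht0 (mul_pos hγ₀ (by linarith))) (by positivity)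
  have h := tauInt_le_of_gapFloor (tensorFun_pos hμ) (sum_tensorFun_eq_one μ hμ1)
    (weightedScheme_isRowStochastic (ptGraphSwap_isRowStochastic hμ) hM hw0 hotOnlyWeight_sum ht0.le ht1.le)
    (weightedScheme_detailedBalance (ptGraphSwap_detailedBalance hμ) hMrev t)
    (flowStar_isIrreducible_of_hot φ hμ hM hM0 hw0 hotOnlyWeight_sum (by simp) ht0 ht1) hc0
    (flowStarPerfect_spectralGap_ge_linear φ hK hμ hμ1 hM hMrev ht0 ht1 hperfect hγ₀ hgap0) hg
  have e : 1 / (min t (γ₀ * (1 - t)) / (10 * K)) = 10 * K / min t (γ₀ * (1 - t)) := by rw [one_div, inv_div]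
  rw [e] at h
  exact h

end Summit.Ventures.LatticeQCDFlow.Scaling

end
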